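import Literature.Topology.FourManifolds.SimplifiedBrokenLefschetzRoundCircle
import Literature.Topology.FourManifolds.CircleSurgeryExistence
import HarnessLib

/-!
# The height family of a genus-one SBLF along a tube about its round circle

Helper `helper_foldNF_family` of stub `helper_sliceGluing_foldNormalForm` (the `S¹`-parametric
fold normal form of the round circle), line `Sketch`, crux `SblfDescent.RungOne`.

(Crux item stmt-SmoothPoincare4-18531; skeleton `Cruxes/RungOne/Lines/Sketch.lean`.)

Let `f : X → S²` be a simplified broken Lefschetz fibration without Lefschetz points whose
round image is the equator, `e : S¹ → X` the round circle parametrised by longitude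
(`f (e u) = (u₀, u₁, 0)`, `IsSimplifiedBrokenLefschetzFibration.exists_isSmoothEmbedding_range_eq_round`)
and `ν₀ : S¹ × ℝ³ ↪ X` a tubular neighbourhood of `e` (`CircleNbhd`).  Lift the circle to the
line by `circlePt t = (cos 2πt, sin 2πt)`.  We record the elementary properties of the lifted
family `F (t, x) = f (ν₀ (circlePt t, x)) ∈ S² ⊆ ℝ³` and of its height
`g (t, x) = ⟪v, F (t, x)⟫` in the direction of a pole `v = (0, 0, ±1)`:
`F` and `g` are `C^∞`; `F (t, 0) = (cos 2πt, sin 2πt, 0)`; `‖F‖ = 1`; `g = v₂ F₂`;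
`g (t, 0) = 0`; and **`dg (t, 0) = 0`** — the whole zero section `ℝ × {0}` is critical for the
height, because a round point `q` is critical for `⟪a, ·⟫ ∘ f` iff `a` is orthogonal to the
tangent of the equator at `f q` (Hayano 2011, Def. 2.1 (4), through the tree's
`isMCriticalPt_height_comp_iff_of_round_of_equator`), which holds for `a = v`.  This is the
input `g (t, 0) = 0`, `∂g (t, 0) = 0` of the parametric Morse lemma along the round circle
(Hirsch 1976, Ch. 6 §1; the tree's `Splitting.exists_periodic_fibrewiseMorseCoords_of_frame`).

## References

* K. Hayano, *On genus-1 simplified broken Lefschetz fibrations*, Algebr. Geom. Topol. 11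
  (2011), Def. 2.1 (4). [Hayano2011]
* M. W. Hirsch, *Differential Topology*, GTM 33 (1976), Ch. 6 §1. [HirschDT1976]
-/

set_option linter.dupNamespace false

noncomputable section

open scoped Manifold ContDiff Topology RealInnerProductSpace
open Set Function Filter Metric Literature.Topology.FourManifolds

namespace Summit.SmoothPoincare4.SmoothPoincare4.Cruxes.RungOne.Sketch

/-- Local notation: `𝔼 n` is the model Euclidean space `EuclideanSpace ℝ (Fin n)`. -/
local notation "𝔼 " n:arg => EuclideanSpace ℝ (Fin n)

/-- Local notation: `𝕊²`, the unit sphere of `ℝ³`. -/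
local notation "𝕊²" => (Metric.sphere (0 : EuclideanSpace ℝ (Fin 3)) (1 : ℝ))

attribute [local instance] Literature.Topology.FourManifolds.fact_finrank_euclideanSpace_succ

/-- **Coordinates of the equatorial inclusion of `circlePt t`**:
`sphereInclusion 1 2 (circlePt t) = (cos 2πt, sin 2πt, 0)`. [folklore] -/
theorem coe_sphereInclusion_circlePt (t : ℝ) :
    ((sphereInclusion 1 2 one_le_two (circlePt t) : 𝕊²) : 𝔼 3) 0 = Real.cos (2 * Real.pi * t) ∧
    ((sphereInclusion 1 2 one_le_two (circlePt t) : 𝕊²) : 𝔼 3) 1 = Real.sin (2 * Real.pi * t) ∧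
    ((sphereInclusion 1 2 one_le_two (circlePt t) : 𝕊²) : 𝔼 3) 2 = 0 := by
  refine ⟨?_, ?_, ?_⟩
  · simp [coe_sphereInclusion, euclideanInclusion_apply, circlePt_eq_circlePoint]
  · simp [coe_sphereInclusion, euclideanInclusion_apply, circlePt_eq_circlePoint]
  · simp [coe_sphereInclusion, euclideanInclusion_apply]

/-- **The standard index-one form of `ℝ³` as a continuous bilinear map**:
`B (a, b) = a₀ b₀ + a₁ b₁ - a₂ b₂` (half the Hessian of the transverse fold slice
`x₀² + x₁² - x₂²`). [folklore] -/
theorem exists_clm_sliceForm : ∃ B : 𝔼 3 →L[ℝ] 𝔼 3 →L[ℝ] ℝ,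
    ∀ a b : 𝔼 3, B a b = a 0 * b 0 + a 1 * b 1 - a 2 * b 2 := by
  refine ⟨(EuclideanSpace.proj (0 : Fin 3) : 𝔼 3 →L[ℝ] ℝ).smulRight
      (EuclideanSpace.proj (0 : Fin 3) : 𝔼 3 →L[ℝ] ℝ) +
    (EuclideanSpace.proj (1 : Fin 3) : 𝔼 3 →L[ℝ] ℝ).smulRight
      (EuclideanSpace.proj (1 : Fin 3) : 𝔼 3 →L[ℝ] ℝ) -
    (EuclideanSpace.proj (2 : Fin 3) : 𝔼 3 →L[ℝ] ℝ).smulRight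
      (EuclideanSpace.proj (2 : Fin 3) : 𝔼 3 →L[ℝ] ℝ), fun a b => ?_⟩
  simp [smul_eq_mul]

/-- **Polar read-off of a plane vector from a nearby angle.**  Let `w = (w₀, w₁) ∈ ℝ²` and
`t ∈ ℝ`; put `c = cos 2πt`, `s = sin 2πt`, `a = w₀ c + w₁ s`, `b = -w₀ s + w₁ c` (the
coordinates of `w` in the frame rotated by `2πt`).  If `a > 0` then, with the offset angle
`θ = arctan (b / a) / 2π`, `w = ‖w‖ (cos 2π(t + θ), sin 2π(t + θ))`. [folklore] -/
theorem eq_sqrt_mul_cos_and_eq_sqrt_mul_sin (w₀ w₁ t : ℝ)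
    (ha : 0 < w₀ * Real.cos (2 * Real.pi * t) + w₁ * Real.sin (2 * Real.pi * t)) :
    w₀ = √(w₀ ^ 2 + w₁ ^ 2) * Real.cos (2 * Real.pi * (t + Real.arctan
      ((-w₀ * Real.sin (2 * Real.pi * t) + w₁ * Real.cos (2 * Real.pi * t)) /
        (w₀ * Real.cos (2 * Real.pi * t) + w₁ * Real.sin (2 * Real.pi * t))) / (2 * Real.pi))) ∧
    w₁ = √(w₀ ^ 2 + w₁ ^ 2) * Real.sin (2 * Real.pi * (t + Real.arctan
      ((-w₀ * Real.sin (2 * Real.pi * t) + w₁ * Real.cos (2 * Real.pi * t)) /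
        (w₀ * Real.cos (2 * Real.pi * t) + w₁ * Real.sin (2 * Real.pi * t))) / (2 * Real.pi))) := by
  set c : ℝ := Real.cos (2 * Real.pi * t) with hc
  set s : ℝ := Real.sin (2 * Real.pi * t) with hs
  set a : ℝ := w₀ * c + w₁ * s with hadef
  set b : ℝ := -w₀ * s + w₁ * c with hbdef
  have hcs : c ^ 2 + s ^ 2 = 1 := by rw [hc, hs]; exact Real.cos_sq_add_sin_sq _
  have h2π : (2 * Real.pi : ℝ) ≠ 0 := by positivity
  have hang : 2 * Real.pi * (t + Real.arctan (b / a) / (2 * Real.pi)) =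
      2 * Real.pi * t + Real.arctan (b / a) := by field_simp
  -- `cos` and `sin` of the offset angle
  have hρ : a ^ 2 + b ^ 2 = w₀ ^ 2 + w₁ ^ 2 := by
    rw [hadef, hbdef]; nlinarith [hcs]
  have hsq : √(1 + (b / a) ^ 2) = √(w₀ ^ 2 + w₁ ^ 2) / a := by
    rw [← hρ, show 1 + (b / a) ^ 2 = (a ^ 2 + b ^ 2) / a ^ 2 by field_simp, Real.sqrt_div' _ (sq_nonneg a), Real.sqrt_sq ha.le]
  have hne : √(w₀ ^ 2 + w₁ ^ 2) ≠ 0 := by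
    rw [← hρ]
    exact Real.sqrt_ne_zero'.2 (by positivity)
  have hcosθ : Real.cos (Real.arctan (b / a)) = a / √(w₀ ^ 2 + w₁ ^ 2) := by
    rw [Real.cos_arctan, hsq]
    field_simp
  have hsinθ : Real.sin (Real.arctan (b / a)) = b / √(w₀ ^ 2 + w₁ ^ 2) := by
    rw [Real.sin_arctan, hsq]
    field_simp
  rw [hang, Real.cos_add, Real.sin_add, ← hc, ← hs, hcosθ, hsinθ]
  constructor
  · field_simp
    rw [hadef, hbdef]
    linear_combination (-w₀) * hcs
  · field_simp
    rw [hadef, hbdef]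
    linear_combination (-w₁) * hcs

/-- **The height family along a tube about the round circle.**  For a Lefschetz-free SBLF
`f : X → S²` with equatorial round image, a pole direction `v = (0, 0, v₂) ∈ S²`, the round
circle `e` parametrised by longitude and a tubular neighbourhood `ν₀` of `e`: the lifted family
`F (t, x) = f (ν₀ (circlePt t, x))` is `C^∞` with `F (t, 0) = (cos 2πt, sin 2πt, 0)` and
`‖F‖² = 1`, and its height `g = ⟪v, F⟫ = v₂ F₂` is `C^∞` with `g (t, 0) = 0` and
`dg (t, 0) = 0` (every round point is critical for the height towards a pole, Hayano 2011,
Def. 2.1 (4)). [cite: Hayano2011, Def. 2.1 (4)] -/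
theorem helper_foldNF_family : ∀ (X : Type) [TopologicalSpace X] [T2Space X] [SecondCountableTopology X] [CompactSpace X] [ChartedSpace (𝔼 4) X] [IsManifold (𝓡 4) ∞ X] (o : SmoothOrientation (𝓡 4) X) (f : X → 𝕊²), IsSimplifiedBrokenLefschetzFibration o f ∅ 0 → f '' ({p : X | ¬ Surjective (mfderiv (𝓡 4) (𝓡 2) f p)} \ (↑(∅ : Finset X) : Set X)) = sphereEquator 1 → ∀ (v : 𝕊²), (v : 𝔼 3) 0 = 0 → (v : 𝔼 3) 1 = 0 → ∀ (e : Metric.sphere (0 : 𝔼 2) 1 → X) (ν₀ : CircleNbhd (𝓡 4) e), Set.range e = {p : X | ¬ Surjective (mfderiv (𝓡 4) (𝓡 2) f p)} \ (↑(∅ : Finset X) : Set X) → (∀ u, f (e u) = sphereInclusion 1 2 one_le_two u) → ContDiff ℝ ∞ (fun q : ℝ × 𝔼 3 => ((f (ν₀.toFun (circlePt q.1, q.2)) : 𝕊²) : 𝔼 3)) ∧ (∀ t : ℝ, ((f (ν₀.toFun (circlePt t, 0)) : 𝕊²) : 𝔼 3) 0 = Real.cos (2 * Real.pi * t) ∧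 ((f (ν₀.toFun (circlePt t, 0)) : 𝕊²) : 𝔼 3) 1 = Real.sin (2 * Real.pi * t) ∧ ((f (ν₀.toFun (circlePt t, 0)) : 𝕊²) : 𝔼 3) 2 = 0) ∧ (∀ q : ℝ × 𝔼 3, ((f (ν₀.toFun (circlePt q.1, q.2)) : 𝕊²) : 𝔼 3) 0 ^ 2 + ((f (ν₀.toFun (circlePt q.1, q.2)) : 𝕊²) : 𝔼 3) 1 ^ 2 + ((f (ν₀.toFun (circlePt q.1, q.2)) : 𝕊²) : 𝔼 3) 2 ^ 2 = 1) ∧ ContDiff ℝ ∞ (fun q : ℝ × 𝔼 3 => SphereHeight.height (v : 𝔼 3) (f (ν₀.toFun (circlePt q.1, q.2)))) ∧ (∀ t : ℝ, SphereHeight.height (v : 𝔼 3) (f (ν₀.toFun (circlePt t, 0))) = 0) ∧ (∀ t : ℝ, fderiv ℝ (fun q : ℝ × 𝔼 3 => SphereHeight.height (v : 𝔼 3) (f (ν₀.toFun (circlePt q.1, q.2)))) (t, 0) = 0) ∧ (∀ q : ℝ × 𝔼 3, SphereHeight.height (v : 𝔼 3) (f (ν₀.toFun (circlePt q.1, q.2)))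 = (v : 𝔼 3) 2 * ((f (ν₀.toFun (circlePt q.1, q.2)) : 𝕊²) : 𝔼 3) 2) := by
  intro X _ _ _ _ _ _ o f hf hround v hv0 hv1 e ν₀ hrange hfe
  -- the lifted tube map `W (t, x) = ν₀ (circlePt t, x)` is smooth
  set W : ℝ × 𝔼 3 → X := fun q => ν₀.toFun (circlePt q.1, q.2) with hW
  have hPm : ContMDiff 𝓘(ℝ, ℝ × 𝔼 3) ((𝓡 1).prod 𝓘(ℝ, 𝔼 3)) ∞
      fun q : ℝ × 𝔼 3 => ((circlePt q.1, q.2) : (Metric.sphere (0 : 𝔼 2) 1) × 𝔼 3) :=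
    (contMDiff_circlePt.comp contDiff_fst.contMDiff).prodMk contDiff_snd.contMDiff
  have hWs : ContMDiff 𝓘(ℝ, ℝ × 𝔼 3) (𝓡 4) ∞ W := ν₀.isSmoothEmbedding.contMDiff.comp hPm
  have hfW : ContMDiff 𝓘(ℝ, ℝ × 𝔼 3) (𝓡 2) ∞ (f ∘ W) := hf.contMDiff.comp hWs
  -- `F = coe ∘ f ∘ W` is smooth
  have hF : ContDiff ℝ ∞ fun q : ℝ × 𝔼 3 => ((f (ν₀.toFun (circlePt q.1, q.2)) : 𝕊²) : 𝔼 3) := by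
    rw [← contMDiff_iff_contDiff]
    exact contMDiff_coe_sphere.comp hfW
  -- the zero section is the round circle, by longitude
  have hW0 : ∀ t : ℝ, W (t, 0) = e (circlePt t) := fun t => by simp [hW, ν₀.apply_zero]
  have hF0 : ∀ t : ℝ, f (ν₀.toFun (circlePt t, 0)) = sphereInclusion 1 2 one_le_two (circlePt t) :=
    fun t => by rw [← hfe, ← hW0 t]
  -- the height is `v₂ F₂`
  have hv : ∀ w : 𝔼 3, ⟪(v : 𝔼 3), w⟫ = (v : 𝔼 3) 2 * w 2 := fun w => by
    rw [BandFoliation.inner_eq_three, hv0, hv1]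
    ring
  have hgF : ∀ q : ℝ × 𝔼 3, SphereHeight.height (v : 𝔼 3) (f (ν₀.toFun (circlePt q.1, q.2))) =
      (v : 𝔼 3) 2 * ((f (ν₀.toFun (circlePt q.1, q.2)) : 𝕊²) : 𝔼 3) 2 := fun q => by
    rw [SphereHeight.height_apply, hv]
  refine ⟨hF, fun t => ?_, fun q => ?_, ?_, fun t => ?_, fun t => ?_, hgF⟩
  · rw [hF0 t]
    exact coe_sphereInclusion_circlePt t
  · -- `‖F‖² = 1`
    set w : 𝔼 3 := ((f (ν₀.toFun (circlePt q.1, q.2)) : 𝕊²) : 𝔼 3) with hw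
    have h1 : ‖w‖ ^ 2 = 1 := by rw [hw, norm_eq_of_mem_sphere, one_pow]
    rw [← real_inner_self_eq_norm_sq, BandFoliation.inner_eq_three] at h1
    nlinarith [h1]
  · -- `g` is smooth
    have : (fun q : ℝ × 𝔼 3 => SphereHeight.height (v : 𝔼 3) (f (ν₀.toFun (circlePt q.1, q.2)))) =
        fun q => (v : 𝔼 3) 2 * ((f (ν₀.toFun (circlePt q.1, q.2)) : 𝕊²) : 𝔼 3) 2 := funext hgF
    rw [this]
    exact contDiff_const.mul ((contDiff_euclidean.1 hF) 2)
  · -- `g (t, 0) = 0`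
    rw [SphereHeight.height_apply, hv, hF0 t, (coe_sphereInclusion_circlePt t).2.2, mul_zero]
  · -- `dg (t, 0) = 0`: the round point `e (circlePt t)` is critical for the height
    have hq : e (circlePt t) ∈ {p : X | ¬ Surjective (mfderiv (𝓡 4) (𝓡 2) f p)} \
        (↑(∅ : Finset X) : Set X) := hrange ▸ mem_range_self _
    have hcrit : IsMCriticalPt (𝓡 4) (SphereHeight.height (v : 𝔼 3) ∘ f) (e (circlePt t)) := by
      rw [hf.isMCriticalPt_height_comp_iff_of_round_of_equator hround hq.1
        (Finset.notMem_empty _) (v : 𝔼 3), hv0, hv1, zero_mul, zero_mul]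
    have hn : (∞ : WithTop ℕ∞) ≠ 0 := by simp
    have hWd : MDifferentiableAt 𝓘(ℝ, ℝ × 𝔼 3) (𝓡 4) W (t, 0) := (hWs _).mdifferentiableAt hn
    have hHd : MDifferentiableAt (𝓡 4) 𝓘(ℝ, ℝ) (SphereHeight.height (v : 𝔼 3) ∘ f) (W (t, 0)) :=
      (((SphereHeight.contMDiff_height (v : 𝔼 3)).comp hf.contMDiff) _).mdifferentiableAt hn
    have hcomp := mfderiv_comp (t, 0) hHd hWd
    unfold IsMCriticalPt at hcrit
    rw [hW0 t] at hcomp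
    rw [hcrit, ContinuousLinearMap.zero_comp] at hcomp
    have hfun : (SphereHeight.height (v : 𝔼 3) ∘ f) ∘ W =
        fun q : ℝ × 𝔼 3 => SphereHeight.height (v : 𝔼 3) (f (ν₀.toFun (circlePt q.1, q.2))) := rfl
    rw [hfun, mfderiv_eq_fderiv] at hcomp
    exact hcomp

end Summit.SmoothPoincare4.SmoothPoincare4.Cruxes.RungOne.Sketch

end
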